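import Mathlib
import Summits.MatrixMultiplication.MatrixMultiplication.Theorems.SubgroupIdentityDesigns.Negative.LinearCharacterLevel

/-!
# Sharpness of the affine-dual criterion: witnesses for all characters give a level-`k` identity test
(calibration lemma for the crux `SubgroupIdentityDesigns`, stmt-MatrixMultiplication-14079; companion of
`Negative.LinearCharacterLevel`; cell B2b-5 lgcu-borel, gen 3)

`Negative.LinearCharacterLevel` showed: if SOME additive form `λ` on `𝔫 = T(M_m(𝔽_p))` has no rank-`≤ k` point on
its affine dual coset, no level-`k` identity test exists on any set containing `1 + 𝔫`.  Here the converse for the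
set `1 + 𝔫` itself: if EVERY form `n ↦ tr(S n)` (`S ∈ M_m(𝔽_p)`; these are all the additive forms on `𝔫`) has a
rank-`≤ k` coset point `W S` (`tr(W S · T e) = tr(S · T e)` for all `e`), then averaging the level-`k` functions
`ψ(−tr W S) ψ(tr(W S ·))` over `S` gives a level-`k` function equal to `[T e = 0]` at `1 + T e`
(`idTest_of_affineDual_witnesses`): the identity-test level of `1 + 𝔫` is EXACTLY
`max_λ min{rk M : M on the coset of λ}`.
Instance (`rank_rectPlaced_le_left/right`, `levelK_idTest_of_rect`, `levelK_idDesign_of_rect`): the rectangular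
pattern `𝔫 = {n : supp n ⊆ R × C}`; the transpose-placed witness `W S = S|_{C × R}` has rank `≤ min(|R|, |C|)`, so
`1 + 𝔫` passes the level-`k` identity test as soon as `|R| ≤ k` or `|C| ≤ k`; with `R ∩ C = ∅` the set `1 + 𝔫` is an
abelian unipotent subgroup (e.g. the radical `{[[1,0],[X,1]] : X ∈ M_{b×a}}`) and any `H₁, H₂, H₃` inside it carry a
level-`k` identity design in the crux's sense.  Together with `no_levelK_design_of_patGrid` (a `(k+1)`-grid inside
`R × C` kills level `k`): the identity-test level of the rectangular pattern group is exactly `min(|R|, |C|)`.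
Sorry-free; no new definitions.  VALUE = theorem (calibration of the level scale), not summit progress.
-/

set_option linter.dupNamespace false

noncomputable section

open scoped BigOperators Classical

namespace Summit.MatrixMultiplication.MatrixMultiplication.Theorems.SubgroupIdentityDesigns.Negative

variable {p m : ℕ} [Fact p.Prime]

/-- `Σ_S ψ(tr(S n)) = 0` for `n ≠ 0` (orthogonality on `M_m(𝔽_p)` for the trace pairing). [folklore] -/
theorem sum_psi_trace_mul_eq_zero (n : CMat p m) (hn : n ≠ 0) :
    ∑ S : CMat p m, (ZMod.stdAddChar (Matrix.trace (S * n)) : ℂ) = 0 := by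
  obtain ⟨a, b, hab⟩ : ∃ a b, n a b ≠ 0 := by
    by_contra h
    push Not at h
    exact hn (Matrix.ext fun a b => by rw [h a b]; rfl)
  let L : CMat p m →+ ZMod p := AddMonoidHom.mk' (fun S : CMat p m => Matrix.trace (S * n)) (by
    intro x y
    rw [Matrix.add_mul, Matrix.trace_add])
  have hL : ∀ S, L S = Matrix.trace (S * n) := fun S => rfl
  have h := sum_psi_addMonoidHom_eq_zero L
    (Matrix.of fun x y => if x = b ∧ y = a then (1 : ZMod p) else 0) (by
      rw [hL, Matrix.trace_mul_comm, trace_mul_elem]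
      exact hab)
  simpa [hL] using h

/-- **WITNESSES FOR ALL FORMS GIVE A LEVEL-`k` IDENTITY TEST ON `1 + 𝔫`.**  If every form `n ↦ tr(S n)` has a
rank-`≤ k` point `W S` on its affine dual coset, then some Fourier table supported in rank `≤ k` gives a function
that is `1` at `1` and `0` at every `1 + T e ≠ 1`. -/
theorem idTest_of_affineDual_witnesses (k : ℕ) (T : CMat p m →+ CMat p m) (W : CMat p m → CMat p m)
    (hW : ∀ S : CMat p m, (W S).rank ≤ k)
    (hwit : ∀ S e : CMat p m, Matrix.trace (W S * T e) = Matrix.trace (S * T e)) :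
    ∃ c : CMat p m → ℂ, (∀ M : CMat p m, k < M.rank → c M = 0) ∧ fourierMat c 1 = 1 ∧
      ∀ e : CMat p m, T e ≠ 0 → fourierMat c (1 + T e) = 0 := by
  let N : ℂ := (Fintype.card (CMat p m) : ℂ)
  have hN : N ≠ 0 := Nat.cast_ne_zero.2 Fintype.card_ne_zero
  let c : CMat p m → ℂ := fun M =>
    N⁻¹ * ∑ S : CMat p m, if W S = M then (ZMod.stdAddChar (- Matrix.trace (W S)) : ℂ) else 0
  have key : ∀ g : CMat p m, fourierMat c g =
      N⁻¹ * ∑ S : CMat p m, (ZMod.stdAddChar (- Matrix.trace (W S)) : ℂ) *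
        ZMod.stdAddChar (Matrix.trace (W S * g)) := by
    intro g
    calc fourierMat c g
        = ∑ M : CMat p m, ∑ S : CMat p m, N⁻¹ * ((if W S = M then
            (ZMod.stdAddChar (- Matrix.trace (W S)) : ℂ) else 0) * ZMod.stdAddChar (Matrix.trace (M * g))) := by
          unfold fourierMat
          refine Finset.sum_congr rfl fun M _ => ?_
          show (N⁻¹ * ∑ S : CMat p m, (if W S = M then (ZMod.stdAddChar (- Matrix.trace (W S)) : ℂ) else 0)) *
              ZMod.stdAddChar (Matrix.trace (M * g)) = _
          rw [Finset.mul_sum, Finset.sum_mul]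
          exact Finset.sum_congr rfl fun S _ => by ring
      _ = ∑ S : CMat p m, ∑ M : CMat p m, N⁻¹ * ((if W S = M then
            (ZMod.stdAddChar (- Matrix.trace (W S)) : ℂ) else 0) * ZMod.stdAddChar (Matrix.trace (M * g))) :=
          Finset.sum_comm
      _ = ∑ S : CMat p m, N⁻¹ * ((ZMod.stdAddChar (- Matrix.trace (W S)) : ℂ) *
            ZMod.stdAddChar (Matrix.trace (W S * g))) := by
          refine Finset.sum_congr rfl fun S _ => ?_
          rw [Finset.sum_eq_single (W S) (fun M _ hM => by rw [if_neg (Ne.symm hM), zero_mul, mul_zero])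
            (fun h => absurd (Finset.mem_univ _) h), if_pos rfl]
      _ = _ := by rw [← Finset.mul_sum]
  refine ⟨c, ?_, ?_, ?_⟩
  · intro M hM
    show N⁻¹ * _ = 0
    rw [Finset.sum_eq_zero fun S _ => ?_, mul_zero]
    rw [if_neg]
    intro h
    have := hW S
    rw [h] at this
    omega
  · rw [key]
    have : ∀ S : CMat p m, (ZMod.stdAddChar (- Matrix.trace (W S)) : ℂ) *
        ZMod.stdAddChar (Matrix.trace (W S * 1)) = 1 := by
      intro S
      rw [Matrix.mul_one, ← AddChar.map_add_eq_mul, neg_add_cancel, AddChar.map_zero_eq_one]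
    simp_rw [this]
    rw [Finset.sum_const, nsmul_eq_mul, mul_one, Finset.card_univ, inv_mul_cancel₀ hN]
  · intro e he
    rw [key]
    have : ∀ S : CMat p m, (ZMod.stdAddChar (- Matrix.trace (W S)) : ℂ) *
        ZMod.stdAddChar (Matrix.trace (W S * (1 + T e))) = ZMod.stdAddChar (Matrix.trace (S * T e)) := by
      intro S
      rw [Matrix.mul_add, Matrix.mul_one, Matrix.trace_add, hwit S e, ← AddChar.map_add_eq_mul]
      congr 1
      ring
    simp_rw [this]
    rw [sum_psi_trace_mul_eq_zero (T e) he, mul_zero]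

/-! ## The rectangular pattern `R × C` -/

/-- The transpose-placed witness `S|_{C × R}` is killed outside the columns `R`: rank `≤ |R|`. -/
theorem rank_rectPlaced_le_left (R C : Finset (Fin m)) (S : CMat p m) :
    (Matrix.of fun x y => if y ∈ R ∧ x ∈ C then S x y else 0 : CMat p m).rank ≤ R.card := by
  set W : CMat p m := Matrix.of fun x y => if y ∈ R ∧ x ∈ C then S x y else 0 with hWdef
  have hfac : W = W * Matrix.diagonal (fun y : Fin m => if y ∈ R then (1 : ZMod p) else 0) := by
    ext x y
    rw [Matrix.mul_diagonal, hWdef, Matrix.of_apply]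
    by_cases hy : y ∈ R
    · rw [if_pos hy, mul_one]
    · rw [if_neg (fun h => hy h.1), if_neg hy, mul_zero]
  rw [hfac]
  refine (Matrix.rank_mul_le_right _ _).trans ?_
  rw [Matrix.rank_diagonal, Fintype.card_subtype]
  apply le_of_eq
  congr 1
  ext y
  simp

/-- … and outside the rows `C`: rank `≤ |C|`. -/
theorem rank_rectPlaced_le_right (R C : Finset (Fin m)) (S : CMat p m) :
    (Matrix.of fun x y => if y ∈ R ∧ x ∈ C then S x y else 0 : CMat p m).rank ≤ C.card := by
  set W : CMat p m := Matrix.of fun x y => if y ∈ R ∧ x ∈ C then S x y else 0 with hWdef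
  have hfac : W = Matrix.diagonal (fun x : Fin m => if x ∈ C then (1 : ZMod p) else 0) * W := by
    ext x y
    rw [Matrix.diagonal_mul, hWdef, Matrix.of_apply]
    by_cases hx : x ∈ C
    · rw [if_pos hx, one_mul]
    · rw [if_neg (fun h => hx h.2), if_neg hx, zero_mul]
  rw [hfac]
  refine (Matrix.rank_mul_le_left _ _).trans ?_
  rw [Matrix.rank_diagonal, Fintype.card_subtype]
  apply le_of_eq
  congr 1
  ext x
  simp

/-- **THE RECTANGULAR PATTERN PASSES AT LEVEL `min(|R|, |C|)`.**  For `𝔫 = {n : supp n ⊆ R × C}` and `k ≥ |R|` or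
`k ≥ |C|`, a Fourier table supported in rank `≤ k` gives a function that is `1` at `1` and `0` at every other point
`1 + n`, `n ∈ 𝔫`. -/
theorem levelK_idTest_of_rect (k : ℕ) (R C : Finset (Fin m)) (hk : R.card ≤ k ∨ C.card ≤ k) :
    ∃ c : CMat p m → ℂ, (∀ M : CMat p m, k < M.rank → c M = 0) ∧ fourierMat c 1 = 1 ∧
      ∀ e : CMat p m, (Matrix.of fun a b => if a ∈ R ∧ b ∈ C then e a b else 0 : CMat p m) ≠ 0 →
        fourierMat c (1 + (Matrix.of fun a b => if a ∈ R ∧ b ∈ C then e a b else 0 : CMat p m)) = 0 := by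
  let T : CMat p m →+ CMat p m := AddMonoidHom.mk'
    (fun e : CMat p m => (Matrix.of fun a b => if a ∈ R ∧ b ∈ C then e a b else 0 : CMat p m)) (by
      intro x y
      ext a b
      simp only [Matrix.of_apply, Matrix.add_apply]
      split_ifs <;> simp)
  have hT : ∀ e, T e = (Matrix.of fun a b => if a ∈ R ∧ b ∈ C then e a b else 0 : CMat p m) := fun e => rfl
  let W : CMat p m → CMat p m := fun S => Matrix.of fun x y => if y ∈ R ∧ x ∈ C then S x y else 0
  have hW : ∀ S, (W S).rank ≤ k := by
    intro S
    rcases hk with h | h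
    · exact (rank_rectPlaced_le_left R C S).trans h
    · exact (rank_rectPlaced_le_right R C S).trans h
  have hwit : ∀ S e : CMat p m, Matrix.trace (W S * T e) = Matrix.trace (S * T e) := by
    intro S e
    simp only [Matrix.trace, Matrix.diag_apply, Matrix.mul_apply, hT, Matrix.of_apply]
    refine Finset.sum_congr rfl fun x _ => Finset.sum_congr rfl fun y _ => ?_
    show (if y ∈ R ∧ x ∈ C then S x y else 0) * (if y ∈ R ∧ x ∈ C then e y x else 0) =
      S x y * (if y ∈ R ∧ x ∈ C then e y x else 0)
    split_ifs <;> simp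
  obtain ⟨c, hc, h1, h0⟩ := idTest_of_affineDual_witnesses k T W hW hwit
  exact ⟨c, hc, h1, fun e he => by rw [← hT] at he ⊢; exact h0 e he⟩

/-- Products inside the rectangular pattern with `R ∩ C = ∅`: `(1 + n)(1 + n') = 1 + n + n'`, so the elements
`u` of `GL_m` with `u - 1` supported on `R × C` are closed under products and `u v - 1 = (u - 1) + (v - 1)`. -/
theorem rect_mul_sub_one {R C : Finset (Fin m)} (hRC : Disjoint R C) (u v : CMat p m)
    (hu : ∀ a b : Fin m, (u - 1) a b ≠ 0 → a ∈ R ∧ b ∈ C)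
    (hv : ∀ a b : Fin m, (v - 1) a b ≠ 0 → a ∈ R ∧ b ∈ C) :
    u * v - 1 = (u - 1) + (v - 1) := by
  have hprod : (u - 1) * (v - 1) = 0 := by
    ext a b
    simp only [Matrix.mul_apply, Matrix.zero_apply]
    refine Finset.sum_eq_zero fun x _ => ?_
    by_cases h1 : (u - 1) a x = 0
    · rw [h1, zero_mul]
    · by_cases h2 : (v - 1) x b = 0
      · rw [h2, mul_zero]
      · exact absurd (Finset.disjoint_left.1 hRC (hv x b h2).1) (fun h => h (hu a x h1).2)
  have : u * v = (1 + (u - 1)) * (1 + (v - 1)) := by simp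
  rw [this, add_mul, mul_add, mul_add, one_mul, one_mul, mul_one, hprod, add_zero]
  abel

/-- **CALIBRATION (crux language).**  If `R ∩ C = ∅`, `|R| ≤ k` or `|C| ≤ k`, and every element `h` of `H₁`, `H₂`,
`H₃` has `h - 1` supported on `R × C` (e.g. all three inside the abelian radical `{[[1,0],[X,1]]}`, `X ∈ M_{b×a}`,
`min(a,b) ≤ k`), then `(H₁, H₂, H₃)` HAS a level-`k` identity design in the sense of the crux's Fourier clause.
(So `no_levelK_design_of_patGrid` is sharp: the identity-test level of the rectangular pattern group is `min(|R|,|C|)`.) -/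
theorem levelK_idDesign_of_rect (k : ℕ) (R C : Finset (Fin m)) (hRC : Disjoint R C)
    (hk : R.card ≤ k ∨ C.card ≤ k)
    {H₁ H₂ H₃ : Subgroup (Matrix.GeneralLinearGroup (Fin m) (ZMod p))}
    (h₁ : ∀ u ∈ H₁, ∀ a b : Fin m, ((u : CMat p m) - 1) a b ≠ 0 → a ∈ R ∧ b ∈ C)
    (h₂ : ∀ u ∈ H₂, ∀ a b : Fin m, ((u : CMat p m) - 1) a b ≠ 0 → a ∈ R ∧ b ∈ C)
    (h₃ : ∀ u ∈ H₃, ∀ a b : Fin m, ((u : CMat p m) - 1) a b ≠ 0 → a ∈ R ∧ b ∈ C) :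
    ∃ c : CMat p m → ℂ, (∀ M : CMat p m, k < M.rank → c M = 0) ∧
      (∑ M : CMat p m, c M * ZMod.stdAddChar (Matrix.trace
        (M * ((1 : Matrix.GeneralLinearGroup (Fin m) (ZMod p)) : CMat p m)))) = 1 ∧
      ∀ a ∈ H₁, ∀ b ∈ H₂, ∀ g ∈ H₃, a * b * g ≠ 1 →
        (∑ M : CMat p m, c M * ZMod.stdAddChar (Matrix.trace
          (M * ((a * b * g : Matrix.GeneralLinearGroup (Fin m) (ZMod p)) : CMat p m)))) = 0 := by
  obtain ⟨c, hc, h1, h0⟩ := levelK_idTest_of_rect (p := p) k R C hk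
  refine ⟨c, hc, by simpa [fourierMat] using h1, ?_⟩
  intro a ha b hb g hg hne
  -- `x = a b g` has `x - 1` supported on `R × C`, and `x = 1 + n_{x-1}`
  have hab : ∀ i j : Fin m, (((a * b : Matrix.GeneralLinearGroup (Fin m) (ZMod p)) : CMat p m) - 1) i j ≠ 0 →
      i ∈ R ∧ j ∈ C := by
    intro i j hij
    rw [Matrix.GeneralLinearGroup.coe_mul, rect_mul_sub_one hRC _ _ (h₁ a ha) (h₂ b hb), Matrix.add_apply] at hij
    by_cases hu : (((a : Matrix.GeneralLinearGroup (Fin m) (ZMod p)) : CMat p m) - 1) i j = 0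
    · rw [hu, zero_add] at hij
      exact h₂ b hb i j hij
    · exact h₁ a ha i j hu
  have habg : ∀ i j : Fin m,
      (((a * b * g : Matrix.GeneralLinearGroup (Fin m) (ZMod p)) : CMat p m) - 1) i j ≠ 0 → i ∈ R ∧ j ∈ C := by
    intro i j hij
    rw [Matrix.GeneralLinearGroup.coe_mul, rect_mul_sub_one hRC _ _ hab (h₃ g hg), Matrix.add_apply] at hij
    by_cases hu : (((a * b : Matrix.GeneralLinearGroup (Fin m) (ZMod p)) : CMat p m) - 1) i j = 0
    · rw [hu, zero_add] at hij
      exact h₃ g hg i j hij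
    · exact hab i j hu
  set x : CMat p m := ((a * b * g : Matrix.GeneralLinearGroup (Fin m) (ZMod p)) : CMat p m) with hx
  have hxn : x = 1 + (Matrix.of fun i j => if i ∈ R ∧ j ∈ C then (x - 1) i j else 0 : CMat p m) := by
    ext i j
    rw [Matrix.add_apply, Matrix.of_apply]
    by_cases hij : i ∈ R ∧ j ∈ C
    · rw [if_pos hij, Matrix.sub_apply]
      ring
    · rw [if_neg hij, add_zero]
      by_contra hne'
      apply hij
      apply habg i j
      rw [Matrix.sub_apply]
      exact sub_ne_zero.2 hne'
  have hn : (Matrix.of fun i j => if i ∈ R ∧ j ∈ C then (x - 1) i j else 0 : CMat p m) ≠ 0 := by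
    intro h0'
    apply hne
    have hx1 : x = 1 := by rw [hxn, h0', add_zero]
    exact Units.ext hx1
  have := h0 (x - 1) hn
  rw [← hxn] at this
  simpa [fourierMat] using this

end Summit.MatrixMultiplication.MatrixMultiplication.Theorems.SubgroupIdentityDesigns.Negative

end
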